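import Summits.QuantumFields.YangMills.Theorems.FluctuationComparisonRegPrIntLOrganTangentJTOfCurvatureTransport
import HarnessLib

/-!
# Crux `FluctuationComparisonRegPrIntL` (stmt-QuantumFields-20520, rung R3), PATH-B organ — «JT-E2E FROM CORNER STABILITY»: the GEOMETRY-FREE (sq-ready) edition of
# ✓p816525 `jtBracket_of_curvatureTransport` — THE (JT-h) BRACKET OF THE FROZEN ROW AT ONE SQUARE FROM {four pair-local square-stability texts at the corners, the curvature
# square clause of `h_Ts∘Φ` on the good set, a crude clause + tail} (DEFINITION-FREE)

Cell `ym3-torus` (YM ladder rung R3 = continuum `SU(2)` Yang–Mills on the three-torus — a RUNG: NOT d = 4, NOT infinite volume, NOT a mass gap, NOT Clay).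
Width seat `ym3-torus-px19` (gen 21); DISCHARGE SPEC v1.4 §9 «sq-programme» (LEAD w3 g26 №38 (2) «every PRODUCER door produces the sq-clause from NEAR-pair inputs by the same
proof with fewer cases … `hglobW` is replaced by NOTHING», №40; crux workfile `DISCHARGE-SPEC-SpreadFibreLawHJ-w3g26.md` 4d2fde2b); `--kind proof --supports
stmt-QuantumFields-20520 --as helper`, count-neutral, no registry ∕ binder ∕ `Lines/` edit, default heartbeats, `autoImplicit false`.

WHAT.  In ✓p816525 the chart GEOMETRY — the one-bond displacement letters `DP ≤ Db, Db′` (`hdisp`), the window-to-window letter `Dw` (`hglob`, FAR-quantified: every pair of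
`θ_j∕4`-window points) and the room `24∕25·θ_Ts + Dw + (Db + Db′)·rc ≤ c·θ_Ts` — enters the proof at exactly ONE place: the internal step (β) deriving the four CORNER-STABILITY texts
`∀ z, mwCut (Φ (Xw, z)) ≠ 0 → ∀ p, dist1 (plaqHol (Φ (X, z)) p) ≤ c·θBal_Ts`, `X ∈ {U, V, W, Y}` (✓p815882 `integrable_logRatio_mul_wgt_of_squareStability`'s `hstab` at the pair
`(X, Xw)`), after which only these four texts are used.  ★★★`jtBracket_of_cornerStability` is ✓p816525 with (β) CUT OUT: the four texts are HYPOTHESES `hstabU hstabV hstabW hstabY`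
(+ `c < 1`), everything else — the frame∕chart facts (α), the admissible square `(U V W Y; B m; B′ m′)` and the law point `Xw` (all `PlaqSmall (θBal_j∕4)`, relational corners), the
DIFFERENTIAL CURVATURE SQUARE CLAUSE of `h_Ts∘Φ(·,z)` on the good set (γ) (✓p814806's (s2) hypothesis verbatim), the crude letter + tail (δ) — and the CONCLUSION (the frozen (JT-h)
conjunct text of `SpreadFibreLawH(J)` [12] (i) at one square: four integrabilities and the bracket bound with letter `kG + ES·kB`) are ✓p816525's CHARACTER FOR CHARACTER; the proof is
✓p816525's (α)(γ)(δ)(ε) verbatim.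
WHY (the near-pair «sq» programme, SPEC v1.4 §9; w4 g24 INSTANCE TABLE 96d7f6a7 §1–§2, TN-HGLOB-FRAME 514ad89e).  Every CONSUMER of (JT-h) instantiates the law point at a CORNER of
the observable's own square (LIN knit ✓p812884 :262 `Xw := Y`); for such NEAR pairs the corner-stability texts follow from the one-bond letter `hdisp` ALONE by ≤ 2 admissible moves
(the «`hdisp`-chaining» brick `…OrganTangentNearDisplacement`, px20 g21, LEAD №42) with room `24∕25·θ_Ts + k·Db·rc ≤ c·θ_Ts` and NO window-to-window letter — whereas the FAR
letter `Dw` of ✓p816525's `hglob` is not dischargeable in print's frames (non-abelian transport term `2·sin(α∕2)·|ζ_⊥| ≈ 0.25·θ_Ts` vs room `θ_Ts∕25`, TN-HGLOB-FRAME §4, instr-1 FL-34).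
So the knit-sq's (JT-h)sq line is `exact jtBracket_of_cornerStability … hstabU hstabV hstabW hstabY …` with the four texts supplied NEAR by the chaining brick, `hglob` replaced by
NOTHING (LEAD №38 (2)); and today's wide door is the special case `hstab_X := ✓p816525 (β)` (= ✓p816275 `plaqSmall_chart_along_square_of_lawPoint` at the four corners) — this
file produces no stability text and consumes no geometry, hence is independent of the (sq1) DEFS bytes and of the brick's bytes.

HONEST FRAMING: a re-cut of landed bookkeeping over HYPOTHESIS clauses; the four corner-stability texts, the curvature square clause, the crude letter and the tail are HYPOTHESES;
nothing of Bałaban's analysis is asserted or proved ([Balaban1985Variational] Thm 1 (9)–(10), Prop 9 (190); [Balaban1987RG1] (0.22)–(0.25) remain the print inputs, NOT constructed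
here); `SpreadFibreLawH(J)`, `SpreadFibreLawHJsq` (to be), `OrganDischargeInputsHJ(sq)`, LIN″, JEN″, JVARᵘ-H″, O1ᵘ-H v2.2, S1aᴴ, S3ᴴ, S2α′, S2β, 26243, the five registered stubs,
crux 20520 `FluctuationComparisonRegPrIntL` and `YM3TorusSU2` are NOT proved; no summit ∕ sub-problem statement is proved; registry `Lines/semiclassical_s2beta.lean` 3732b7df
untouched; rung R3 = SU(2) YM₃ on T³ at fixed lattice data — NOT d = 4, NOT infinite volume, NOT a mass gap, NOT Clay; the Yang–Mills mass gap is NOT proved.  [folklore]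
-/

set_option autoImplicit false

noncomputable section

namespace Summit.QuantumFields.YangMills.Theorems.OrganTangentJTOfCornerStability

open MeasureTheory Filter Topology Function Set
open scoped ENNReal NNReal BigOperators
open Literature.MathematicalPhysics.QuantumFieldTheory.Balaban1983to89 T3ContinuumYM3Torus T3NestedUnitLaws
  T3UnitLawDensityEML T4Continuum BalabanUVClass T3UnitScaleTilt T3LevelShift T3TiltDescent
open T4CubeChartExp (expPt)
open Summit.QuantumFields.YangMills.Theorems.FluctuationComparisonRegPrIntLRunpairOrganFibreLaw (mwCut wNum wgt)
open Summit.QuantumFields.YangMills.Theorems.OrganTangentFibreWeightNormalisation (wgt_normalised)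
open Summit.QuantumFields.YangMills.Theorems.OrganTangentFibreWeightSquareIntegrability (integrable_logRatio_mul_wgt_of_squareStability)
open Summit.QuantumFields.YangMills.Theorems.OrganTangentSecondDiffIntegration (abs_integral_secondDiff_mul_le_good_add_tail secondDiff_letter_bound)
open Summit.QuantumFields.YangMills.Theorems.OrganTangentPullbackSquareCurvOrgan (hClauseSq_of_curvSquare)
open Summit.QuantumFields.YangMills.Theorems.OrganTangentJTOfCurvatureTransport (wgt_interp_nonneg)

/-- ★★★ **JT-E2E FROM CORNER STABILITY** (the geometry-free, sq-ready edition of ✓p816525).  THE (JT-h) CONJUNCT TEXT of the frozen row `SpreadFibreLawH(J)` at ONE admissible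
square `(U V W Y; B m; B′ m′)` and ONE law point `Xw`, for ONE real `t`, FROM: the frame∕chart facts (α); the four PAIR-LOCAL CORNER-STABILITY texts `hstabU hstabV hstabW hstabY`
(`mwCut (Φ (Xw, z)) ≠ 0 ⟹ Φ (X, z) ∈` the closed `c·θBal_Ts`-window, `c < 1`; ✓p815882's `hstab` shape — HYPOTHESES, supplied NEAR by `hdisp`-chaining or WIDE by ✓p816525 (β));
the DIFFERENTIAL CURVATURE SQUARE CLAUSE of `h_Ts∘Φ(·,z)` on a measurable good set (γ); a crude letter `kB` on `{ŵ ≠ 0}` and a tail `ES` (δ).  Letter: `kG + ES·kB`,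
`kG := Σ_{p q} KP p B·k̃ p q·KP q B′ + Σ_p g̃ p·KP2 p B B′`.  Conclusion and (α)(γ)(δ) binders = ✓p816525's character for character. [folklore] -/
theorem jtBracket_of_cornerStability (F : T3Family) (γ b₀ p₀ : ℝ) (j Ts : ℕ) (hjTs : j + 1 ≤ Ts)
    (ρ ρ' : (i : ℕ) → GaugeField (F.P i) 0 ↥(Matrix.specialUnitaryGroup (Fin 2) ℂ) → ℝ)
    (hρm : Measurable (ρ Ts)) (hρ'm : Measurable (ρ' Ts))
    (hρc : ContinuousOn (ρ Ts) {U | PlaqSmall (θBal F.L γ b₀ p₀ Ts) U}) (hρ'c : ContinuousOn (ρ' Ts) {U | PlaqSmall (θBal F.L γ b₀ p₀ Ts) U})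
    (hρpos : ∀ U, PlaqSmall (θBal F.L γ b₀ p₀ Ts) U → 0 < ρ Ts U ∧ 0 < ρ' Ts U)
    (hθ : 0 < θBal F.L γ b₀ p₀ Ts) (hθj : 0 < θBal F.L γ b₀ p₀ j)
    (hχc : Continuous (mwCut F γ b₀ p₀ j Ts)) (hχ0 : ∀ U, 0 ≤ mwCut F γ b₀ p₀ j Ts U)
    (hχsupp : ∀ U, mwCut F γ b₀ p₀ j Ts U ≠ 0 → ∀ (n : ℕ) (hjn : j + 1 ≤ n) (hnK : n ≤ Ts), PlaqSmall (24 / 25 * θBal F.L γ b₀ p₀ n) (descendTo F ℰp n Ts hnK U))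
    (hχpos : ∀ U, (∀ (n : ℕ) (hjn : j + 1 ≤ n) (hnK : n ≤ Ts), PlaqSmall (24 / 25 * θBal F.L γ b₀ p₀ n) (descendTo F ℰp n Ts hnK U)) → 0 < mwCut F γ b₀ p₀ j Ts U)
    {Z : Type} [MeasurableSpace Z] (τ : Measure Z) [IsProbabilityMeasure τ]
    (Φ : GaugeField (F.P j) 0 ↥(Matrix.specialUnitaryGroup (Fin 2) ℂ) × Z → GaugeField (F.P Ts) 0 ↥(Matrix.specialUnitaryGroup (Fin 2) ℂ))
    (J : GaugeField (F.P j) 0 ↥(Matrix.specialUnitaryGroup (Fin 2) ℂ) × Z → ℝ≥0)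
    (hΦm : Measurable Φ) (hJm : Measurable J) (CJ : ℝ) (hJle : ∀ V z, (J (V, z) : ℝ) ≤ CJ)
    (hpos : ∀ V, PlaqSmall (θBal F.L γ b₀ p₀ j) V →
      0 < ∫⁻ z in {z | (∀ (n : ℕ) (hjn : j + 1 ≤ n) (hnK : n ≤ Ts), PlaqSmall (24 / 25 * θBal F.L γ b₀ p₀ n) (descendTo F ℰp n Ts hnK (Φ (V, z))))},
        (J (V, z) : ℝ≥0∞) ∂τ)
    (t : ℝ)
    -- (β′) CORNER STABILITY: the four PAIR-LOCAL square-stability texts (✓p815882's `hstab` shape) at the corners w.r.t. the law point `Xw` — HYPOTHESES here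
    {rc c : ℝ} (hc : c < 1)
    -- the square and the law point
    (B B' : PBond (F.P j) 0) (m m' : Fin 3 → ℝ) (U V W Y Xw : GaugeField (F.P j) 0 ↥(Matrix.specialUnitaryGroup (Fin 2) ℂ))
    (hm : ‖m‖ ≤ rc * (θBal F.L γ b₀ p₀ j / 4)) (hm' : ‖m'‖ ≤ rc * (θBal F.L γ b₀ p₀ j / 4))
    (hU : PlaqSmall (θBal F.L γ b₀ p₀ j / 4) U) (hV : PlaqSmall (θBal F.L γ b₀ p₀ j / 4) V) (hW : PlaqSmall (θBal F.L γ b₀ p₀ j / 4) W)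
    (hY : PlaqSmall (θBal F.L γ b₀ p₀ j / 4) Y) (hXw : PlaqSmall (θBal F.L γ b₀ p₀ j / 4) Xw)
    (hVU : ∀ e, e ≠ B → V e = U e) (hVb : V B = U B * expPt m) (hWU : ∀ e, e ≠ B' → W e = U e) (hWb : W B' = U B' * expPt m')
    (hYV : ∀ e, e ≠ B' → Y e = V e) (hYb : Y B' = V B' * expPt m')
    (hstabU : ∀ z, mwCut F γ b₀ p₀ j Ts (Φ (Xw, z)) ≠ 0 → ∀ p, dist1 (GaugeField.plaqHol (Φ (U, z)) p) ≤ c * θBal F.L γ b₀ p₀ Ts)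
    (hstabV : ∀ z, mwCut F γ b₀ p₀ j Ts (Φ (Xw, z)) ≠ 0 → ∀ p, dist1 (GaugeField.plaqHol (Φ (V, z)) p) ≤ c * θBal F.L γ b₀ p₀ Ts)
    (hstabW : ∀ z, mwCut F γ b₀ p₀ j Ts (Φ (Xw, z)) ≠ 0 → ∀ p, dist1 (GaugeField.plaqHol (Φ (W, z)) p) ≤ c * θBal F.L γ b₀ p₀ Ts)
    (hstabY : ∀ z, mwCut F γ b₀ p₀ j Ts (Φ (Xw, z)) ≠ 0 → ∀ p, dist1 (GaugeField.plaqHol (Φ (Y, z)) p) ≤ c * θBal F.L γ b₀ p₀ Ts)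
    -- (γ) the curvature square clause of `h_Ts ∘ Φ(·, z)` on the good set (✓p814806's (s2) hypothesis, z-uniform letters)
    {ιP : Type*} [Fintype ιP] (kP : ιP → ιP → ℝ) (gP : ιP → ℝ) (KP : ιP → PBond (F.P j) 0 → ℝ) (KP2 : ιP → PBond (F.P j) 0 → PBond (F.P j) 0 → ℝ)
    (hk : ∀ p q, 0 ≤ kP p q) (hg : ∀ p, 0 ≤ gP p) (hKP : ∀ p b, 0 ≤ KP p b) (hKP2 : ∀ p b b', 0 ≤ KP2 p b b')
    (Good : Set Z) (hGood : MeasurableSet Good)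
    (hcurv : ∀ z ∈ Good, wgt F γ b₀ p₀ j Ts ρ ρ' τ Φ J t Xw z ≠ 0 →
      ∀ (b b' : PBond (F.P j) 0) (v v' : Fin 3 → ℝ) (X : GaugeField (F.P j) 0 ↥(Matrix.specialUnitaryGroup (Fin 2) ℂ)),
      ‖v‖ ≤ rc * (θBal F.L γ b₀ p₀ j / 4) → ‖v'‖ ≤ rc * (θBal F.L γ b₀ p₀ j / 4) → PlaqSmall (θBal F.L γ b₀ p₀ j / 4) X →
      PlaqSmall (θBal F.L γ b₀ p₀ j / 4) (update X b (X b * expPt v)) → PlaqSmall (θBal F.L γ b₀ p₀ j / 4) (update X b' (X b' * expPt v')) →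
      PlaqSmall (θBal F.L γ b₀ p₀ j / 4) (update (update X b (X b * expPt v)) b' ((update X b (X b * expPt v)) b' * expPt v')) →
      ∃ (F₂ F₁₂ : ℝ → ℝ → ℝ) (α α' γ' : ιP → ℝ → ℝ → ℝ),
        (∀ t' ∈ Icc (0 : ℝ) 1, HasDerivWithinAt
          (fun t' => (fun X' => Real.log (ρ Ts (Φ (X', z))) - Real.log (ρ' Ts (Φ (X', z))))
            (update (update X b (X b * expPt ((0 : ℝ) • v))) b' ((update X b (X b * expPt ((0 : ℝ) • v))) b' * expPt (t' • v'))))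
          (F₂ 0 t') (Icc 0 1) t') ∧
        (∀ t' ∈ Icc (0 : ℝ) 1, HasDerivWithinAt
          (fun t' => (fun X' => Real.log (ρ Ts (Φ (X', z))) - Real.log (ρ' Ts (Φ (X', z))))
            (update (update X b (X b * expPt ((1 : ℝ) • v))) b' ((update X b (X b * expPt ((1 : ℝ) • v))) b' * expPt (t' • v'))))
          (F₂ 1 t') (Icc 0 1) t') ∧
        (∀ t' ∈ Icc (0 : ℝ) 1, ∀ s ∈ Icc (0 : ℝ) 1, HasDerivWithinAt (fun s => F₂ s t') (F₁₂ s t') (Icc 0 1) s) ∧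
        (∀ p, ∀ s ∈ Icc (0 : ℝ) 1, ∀ t' ∈ Icc (0 : ℝ) 1, 0 ≤ α p s t' ∧ α p s t' ≤ KP p b * (‖v‖ / (θBal F.L γ b₀ p₀ j / 4))) ∧
        (∀ q, ∀ s ∈ Icc (0 : ℝ) 1, ∀ t' ∈ Icc (0 : ℝ) 1, 0 ≤ α' q s t' ∧ α' q s t' ≤ KP q b' * (‖v'‖ / (θBal F.L γ b₀ p₀ j / 4))) ∧
        (∀ p, ∀ s ∈ Icc (0 : ℝ) 1, ∀ t' ∈ Icc (0 : ℝ) 1,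
          0 ≤ γ' p s t' ∧ γ' p s t' ≤ KP2 p b b' * (‖v‖ / (θBal F.L γ b₀ p₀ j / 4)) * (‖v'‖ / (θBal F.L γ b₀ p₀ j / 4))) ∧
        (∀ s ∈ Icc (0 : ℝ) 1, ∀ t' ∈ Icc (0 : ℝ) 1,
          |F₁₂ s t'| ≤ ∑ p, ∑ q, α p s t' * kP p q * α' q s t' + ∑ p, gP p * γ' p s t'))
    -- (δ) crude letter on the law's support and tail of the good set
    {kB ES : ℝ} (hkB : 0 ≤ kB) (hES : 0 ≤ ES)
    (hcrude : ∀ z, wgt F γ b₀ p₀ j Ts ρ ρ' τ Φ J t Xw z ≠ 0 →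
      |(Real.log (ρ Ts (Φ (Y, z))) - Real.log (ρ' Ts (Φ (Y, z)))) - (Real.log (ρ Ts (Φ (V, z))) - Real.log (ρ' Ts (Φ (V, z))))
        - (Real.log (ρ Ts (Φ (W, z))) - Real.log (ρ' Ts (Φ (W, z)))) + (Real.log (ρ Ts (Φ (U, z))) - Real.log (ρ' Ts (Φ (U, z))))|
        ≤ kB * (‖m‖ / (θBal F.L γ b₀ p₀ j / 4)) * (‖m'‖ / (θBal F.L γ b₀ p₀ j / 4)))
    (htail : ∫ z in Goodᶜ, wgt F γ b₀ p₀ j Ts ρ ρ' τ Φ J t Xw z ∂τ ≤ ES) :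
    Integrable (fun z => (Real.log (ρ Ts (Φ (U, z))) - Real.log (ρ' Ts (Φ (U, z)))) * (wgt F γ b₀ p₀ j Ts ρ ρ' τ Φ J t) Xw z) τ ∧
    Integrable (fun z => (Real.log (ρ Ts (Φ (V, z))) - Real.log (ρ' Ts (Φ (V, z)))) * (wgt F γ b₀ p₀ j Ts ρ ρ' τ Φ J t) Xw z) τ ∧
    Integrable (fun z => (Real.log (ρ Ts (Φ (W, z))) - Real.log (ρ' Ts (Φ (W, z)))) * (wgt F γ b₀ p₀ j Ts ρ ρ' τ Φ J t) Xw z) τ ∧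
    Integrable (fun z => (Real.log (ρ Ts (Φ (Y, z))) - Real.log (ρ' Ts (Φ (Y, z)))) * (wgt F γ b₀ p₀ j Ts ρ ρ' τ Φ J t) Xw z) τ ∧
    |∫ z, ((Real.log (ρ Ts (Φ (Y, z))) - Real.log (ρ' Ts (Φ (Y, z)))) - (Real.log (ρ Ts (Φ (V, z))) - Real.log (ρ' Ts (Φ (V, z))))
      - (Real.log (ρ Ts (Φ (W, z))) - Real.log (ρ' Ts (Φ (W, z)))) + (Real.log (ρ Ts (Φ (U, z))) - Real.log (ρ' Ts (Φ (U, z)))))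
        * (wgt F γ b₀ p₀ j Ts ρ ρ' τ Φ J t) Xw z ∂τ|
      ≤ ((∑ p, ∑ q, KP p B * kP p q * KP q B' + ∑ p, gP p * KP2 p B B') + ES * kB)
        * (‖m‖ / (θBal F.L γ b₀ p₀ j / 4)) * (‖m'‖ / (θBal F.L γ b₀ p₀ j / 4)) := by
  -- abbreviations
  set θc : ℝ := θBal F.L γ b₀ p₀ j / 4 with hθc
  set ŵ : Z → ℝ := fun z => wgt F γ b₀ p₀ j Ts ρ ρ' τ Φ J t Xw z with hŵ
  have hθc0 : 0 < θc := by rw [hθc]; positivity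
  have hθc_le : θc ≤ θBal F.L γ b₀ p₀ j := by rw [hθc]; linarith
  have hXwj : PlaqSmall (θBal F.L γ b₀ p₀ j) Xw := fun p => lt_of_lt_of_le (hXw p) hθc_le
  -- (α) the law is a probability law with a non-negative density
  obtain ⟨_, hmass, hwi, hwn⟩ := wgt_normalised F γ b₀ p₀ j Ts hjTs ρ ρ' hρm hρ'm hρc hρ'c hρpos hθ hχc hχ0 hχsupp hχpos τ Φ J
    hΦm hJm CJ hJle hpos t Xw hXwj
  have hwnn : ∀ z, 0 ≤ ŵ z := fun z => wgt_interp_nonneg F γ b₀ p₀ j Ts ρ ρ' hρpos hθ hχ0 hχsupp hjTs τ Φ J t Xw hmass z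
  -- the four integrabilities (LEAD №17 ✓p815882) from the four corner-stability texts
  have hint : ∀ (X : GaugeField (F.P j) 0 ↥(Matrix.specialUnitaryGroup (Fin 2) ℂ)),
      (∀ z, mwCut F γ b₀ p₀ j Ts (Φ (Xw, z)) ≠ 0 → ∀ p, dist1 (GaugeField.plaqHol (Φ (X, z)) p) ≤ c * θBal F.L γ b₀ p₀ Ts) →
      Integrable (fun z => (Real.log (ρ Ts (Φ (X, z))) - Real.log (ρ' Ts (Φ (X, z)))) * wgt F γ b₀ p₀ j Ts ρ ρ' τ Φ J t Xw z) τ :=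
    fun X hX => (integrable_logRatio_mul_wgt_of_squareStability F γ b₀ p₀ j Ts hjTs ρ ρ' hρm hρ'm hρc hρ'c hρpos hθ hχc hχ0 hχsupp hχpos τ Φ J
      hΦm hJm CJ hJle hpos c hc t X Xw hXwj hX).1
  refine ⟨hint U hstabU, hint V hstabV, hint W hstabW, hint Y hstabY, ?_⟩
  -- (γ) the good-set pointwise letter from the curvature square clause (✓p814806)
  set kG : ℝ := ∑ p, ∑ q, KP p B * kP p q * KP q B' + ∑ p, gP p * KP2 p B B' with hkG
  have hkG0 : 0 ≤ kG :=
    add_nonneg (Finset.sum_nonneg fun p _ => Finset.sum_nonneg fun q _ => mul_nonneg (mul_nonneg (hKP p B) (hk p q)) (hKP q B'))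
      (Finset.sum_nonneg fun p _ => mul_nonneg (hg p) (hKP2 p B B'))
  have hsz : 0 ≤ ‖m‖ / θc := div_nonneg (norm_nonneg _) hθc0.le
  have hsz' : 0 ≤ ‖m'‖ / θc := div_nonneg (norm_nonneg _) hθc0.le
  have hG : ∀ z ∈ Good, ŵ z ≠ 0 →
      |(Real.log (ρ Ts (Φ (Y, z))) - Real.log (ρ' Ts (Φ (Y, z)))) - (Real.log (ρ Ts (Φ (V, z))) - Real.log (ρ' Ts (Φ (V, z))))
        - (Real.log (ρ Ts (Φ (W, z))) - Real.log (ρ' Ts (Φ (W, z)))) + (Real.log (ρ Ts (Φ (U, z))) - Real.log (ρ' Ts (Φ (U, z))))|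
        ≤ kG * (‖m‖ / θc) * (‖m'‖ / θc) := by
    intro z hzG hzw
    exact hClauseSq_of_curvSquare (fun X' => Real.log (ρ Ts (Φ (X', z))) - Real.log (ρ' Ts (Φ (X', z)))) kP gP KP KP2 hk hg
      (hcurv z hzG hzw) B B' m m' U V W Y hm hm' hU hV hW hY hVU hVb hWU hWb hYV hYb
  -- (ε) integrate: JT-INT
  have hI := abs_integral_secondDiff_mul_le_good_add_tail τ
    (fun z => Real.log (ρ Ts (Φ (U, z))) - Real.log (ρ' Ts (Φ (U, z))))
    (fun z => Real.log (ρ Ts (Φ (V, z))) - Real.log (ρ' Ts (Φ (V, z))))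
    (fun z => Real.log (ρ Ts (Φ (W, z))) - Real.log (ρ' Ts (Φ (W, z))))
    (fun z => Real.log (ρ Ts (Φ (Y, z))) - Real.log (ρ' Ts (Φ (Y, z))))
    ŵ Good hGood hwi hwnn hwn ES htail (kG * (‖m‖ / θc) * (‖m'‖ / θc)) (kB * (‖m‖ / θc) * (‖m'‖ / θc))
    (mul_nonneg (mul_nonneg hkG0 hsz) hsz') (mul_nonneg (mul_nonneg hkB hsz) hsz') hG (fun z hz => hcrude z hz)
  have hfin := (secondDiff_letter_bound (I := ∫ z, ((Real.log (ρ Ts (Φ (Y, z))) - Real.log (ρ' Ts (Φ (Y, z))))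
      - (Real.log (ρ Ts (Φ (V, z))) - Real.log (ρ' Ts (Φ (V, z)))) - (Real.log (ρ Ts (Φ (W, z))) - Real.log (ρ' Ts (Φ (W, z))))
      + (Real.log (ρ Ts (Φ (U, z))) - Real.log (ρ' Ts (Φ (U, z))))) * ŵ z ∂τ)
    hkG0 hkB hES (by
      have e : kG * (‖m‖ / θc) * (‖m'‖ / θc) + kB * (‖m‖ / θc) * (‖m'‖ / θc) * ES
          = kG * (‖m‖ / θc) * (‖m'‖ / θc) + (kB * (‖m‖ / θc) * (‖m'‖ / θc)) * ES := by ring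
      rw [e]; exact hI)).2
  exact hfin

end Summit.QuantumFields.YangMills.Theorems.OrganTangentJTOfCornerStability

end
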